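import Summits.QuantumFields.BalabanUV.Beta.FP.LevelZeroDoorShapes

/-!
# `BalabanUV.Beta.FP.NestedDoorSocket` — road «FP» for binder row D1, ROUTE T, memo `N2B-DESIGN.md` (35h) ∕ SPEC #41 «THE `j ≥ 2` ASSEMBLY», STEP 1
# CONCRETE FOR THE TOWER's DOOR: **#21's CONCLUSION SHAPE, READ AS A FUNCTION OF THE DIRECTION, IS A DIRECTIONAL DOOR — HENCE #20 §5's THREE TORUS
# KERNELS ON EVERY FINITE FAMILY OF DIRECTIONS** (the twin of #36b `LevelZeroDoorSocket` for #21 `NestedStepLawTorusCompositeOneShotTop`)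

WHY.  #21 `secondVar_oneShot_nestedStepLaw_torus_composite_graded_oneShot_of_uTop` (p335338 ✓) is the (j, m ≥ 2) torus call of the comb TOWER: per ONE
direction `(h, λ)` and its coarse generator `X̄`, a `secondVar` identity `N = F + G` of three GRADED zero-slice bordered systems — `N` the one-shot literal
of depth `n+2` (base `kkt H₀ [𝔔₀; P]`, jets `H′₁ 𝔔′₁ H′₂ 𝔔′₂` NAMED by the graded `X`-conjugated words `k1 k2 q1 q2`), `F` the one-shot system of the tower
below (base `kkt H₀ [Q₁₀; τ₁]`, jets `H₁ [Q₁₁;0] H₂ [Q₁₂;0]` FREE), `G` the top comb slice (base `kkt S₁₁ [Q₂₀; τ₂]`, jets = the DRESSED WORDS of the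
`F`-jets through `Γ I L S` + the top averaging jets `Q₂₁ Q₂₂`).  #33 `DirectionalDoorKernelLaw.mixedVar_kernel_law_of_directional_door` turns a door that
holds for EVERY direction with LINEAR first jets and BILINEAR second jets into the identity of three torus kernels on every finite family of directions
(polarisation + packing, #20).  THIS FILE discharges #33's linearity hypotheses for #21's jet SHAPES and packages the result as a SOCKET whose ONE
hypothesis `hdoor` is #21's conclusion read as a function of the direction `v ∈ V` (an abstract real module; at the assembly: the top-bond weights, every
finer datum — nested column `h`, tree-gauge parameter `λ`, coarse generator `X̄` — a LINEAR image of `v`).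
* §1 THE `X`-CONJUGATED GRADED WORDS ARE (BI)LINEAR: `k1_word_lin` (`v ↦ −X(v)ᵀH₀ + H₁(v) + H₀X(v)`), `k2_word_lin_left ∕ _right` (the two-slot reading
  of `k2`'s word, first factors along `v`, second along `v′`), `comp₁_lin` (`𝔔₁(v) = Q₂₁(v)Q₁₀ + Q₂₀Q₁₁(v)`), `comp₂_lin_left ∕ _right` (`𝔔₂`),
  `q1_word_lin`, `q2_word_lin_left ∕ _right` — [folklore] distributivity, in #33 §4's one-hypothesis currency.
* §2 **`mixedVar_kernel_law_of_nested_door`** — THE SOCKET: the `F`-jets `H₁ Q₁₁ Q₂₁` (linear) and `H₂ Q₁₂ Q₂₂` (bilinear, read in two slots) ABSTRACT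
  with displayed (bi)linearity (they are FREE in #21; an2's namings bind them at the record), the generators `X X̄` linear, the composite jets `𝔔₁ 𝔔₂`
  and the one-shot jets `H′₁ H′₂ 𝔔′₁ 𝔔′₂` BY THEIR DEFINING EQUATIONS (#21's `h𝔔₁ h𝔔₂ k1 k2 q1 q2` as functions of the direction), the `G`-side
  dressed words `Gw₁ Gw₂` NAMED by their defining equations (#36b's `hGw₁ hGw₂` shapes VERBATIM); `hdoor` = #21's conclusion at `(H₁ v, H₂ v v, …)` for
  every `v`; conclusion = #33's three-kernel identity at every pair `(k, l)` of a finite family `d : σ → V`, second jets SYMMETRISED (no free order-2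
  slot: #21 carries none).  Proof: §1 + #36a `orderOne_word_lin ∕ orderTwo_word_lin_left∕_right` + ONE call of #33 at the zero free slot.
[folklore] finite (bi)linear algebra; no `def`, no `def … : Prop`, nothing cited, 0 sorry; the door is a HYPOTHESIS here (nothing of #21's rows, of the
dictionary or of Bałaban's asserted).  NOT HERE: #21's rows (the adapter `NestedDoorSocketTower`), legs (leaf-05 ∕ #39), de-periodisation ((P2‴)), the END.

HONEST DEPENDENCY (page 1, mandatory): continuum YM on T⁴ ⇐ BetaPertH ∧ nine spine estimates (0/9 proved); BetaPertH ⇐ (D1) ∧ (D4) ∧ CAP+tail;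
G-an2-4 gates asym, D1 and NE2/3/4.  HONEST FRAMING (cell contract, verbatim): «discharging `BetaPertH` makes Bałaban's UV stability UNCONDITIONAL —
a real constructive-QFT result; it is NOT the continuum limit and NOT the Clay problem.»  ABSOLUTE RULE (cell charter, verbatim): «No internally-minted
statement may enter as a cited fact. Every hypothesis is either kernel-proved in this package or a verbatim quotation of a PUBLISHED theorem with page
reference. The manuscript(s) under audit are NOT citable for their own disputed steps — they are the thing under adjudication; programme-internal
(2001/route/tribunal) claims are never citable.»  0 estimates; 0∕4 row-D1 binders (hW, hR, D1Tel, D1Rep); NOT (T-ID), NOT SDF, NOT D1, NOT BetaPertH,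
NOT continuum, NOT Clay.  Road «FP» OWNER, b2b-balaban-beta-d1-p3 gen 27, 2026-08-23.  No existing file touched.
-/

noncomputable section

open scoped BigOperators Matrix

namespace Summit.QuantumFields.BalabanUV.Beta.FP.NestedDoorSocket

open Matrix
open Literature.MathematicalPhysics.QuantumFieldTheory.Balaban1983to89.Beta.Composition (kkt)
open Summit.QuantumFields.BalabanUV.Beta.D1BFx.LogDetSecondVariation (secondVar)
open Summit.QuantumFields.BalabanUV.Beta.FP.SecondVarPolarisation (mixedVar)
open Summit.QuantumFields.BalabanUV.Beta.FP.DirectionalDoorKernelLaw (mixedVar_kernel_law_of_directional_door)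
open Summit.QuantumFields.BalabanUV.Beta.FP.LevelZeroDoorShapes (fromRows_zero_lin toBlocks₁₁_lin orderOne_word_lin orderTwo_word_lin_left
  orderTwo_word_lin_right)

/-! ## §1 The `X`-conjugated graded words and the composite averaging jets are (bi)linear in the direction -/

section Words

variable {V ν κ π : Type*} [AddCommGroup V] [Module ℝ V] [Fintype ν] [Fintype κ] [Fintype π]

/-- [folklore] **`k1`'s WORD IS LINEAR**: `v ↦ −X(v)ᵀ·H₀ + H₁(v) + H₀·X(v)` for linear `X H₁`. -/
theorem k1_word_lin (H₀ : Matrix ν ν ℝ) (X H₁ : V → Matrix ν ν ℝ)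
    (hX : ∀ (c : ℝ) (x y : V), X (c • x + y) = c • X x + X y) (hH₁ : ∀ (c : ℝ) (x y : V), H₁ (c • x + y) = c • H₁ x + H₁ y) (c : ℝ) (x y : V) :
    -((X (c • x + y))ᵀ * H₀) + H₁ (c • x + y) + H₀ * X (c • x + y)
      = c • (-((X x)ᵀ * H₀) + H₁ x + H₀ * X x) + (-((X y)ᵀ * H₀) + H₁ y + H₀ * X y) := by
  rw [hX, hH₁]
  simp only [Matrix.transpose_add, Matrix.transpose_smul, Matrix.add_mul, Matrix.smul_mul, Matrix.mul_add, Matrix.mul_smul, smul_add, smul_neg,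
    neg_add]
  abel

/-- [folklore] **`k2`'s WORD, READ IN TWO SLOTS, IS LINEAR IN THE LEFT DIRECTION** (first factors along `v`, second factors along `v′`; linear `X H₁`,
`H₂` linear in its left slot). -/
theorem k2_word_lin_left (H₀ : Matrix ν ν ℝ) (X H₁ : V → Matrix ν ν ℝ) (H₂ : V → V → Matrix ν ν ℝ)
    (hX : ∀ (c : ℝ) (x y : V), X (c • x + y) = c • X x + X y) (hH₁ : ∀ (c : ℝ) (x y : V), H₁ (c • x + y) = c • H₁ x + H₁ y)
    (hH₂ : ∀ (c : ℝ) (x y z : V), H₂ (c • x + y) z = c • H₂ x z + H₂ y z) (c : ℝ) (x y z : V) :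
    (X (c • x + y) * X z)ᵀ * H₀ + (-((X (c • x + y))ᵀ * H₁ z) + -((X (c • x + y))ᵀ * H₀ * X z))
        + ((-((X (c • x + y))ᵀ * H₁ z) + -((X (c • x + y))ᵀ * H₀ * X z))
          + (H₂ (c • x + y) z + H₁ (c • x + y) * X z + (H₁ (c • x + y) * X z + H₀ * (X (c • x + y) * X z))))
      = c • ((X x * X z)ᵀ * H₀ + (-((X x)ᵀ * H₁ z) + -((X x)ᵀ * H₀ * X z))
          + ((-((X x)ᵀ * H₁ z) + -((X x)ᵀ * H₀ * X z)) + (H₂ x z + H₁ x * X z + (H₁ x * X z + H₀ * (X x * X z)))))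
        + ((X y * X z)ᵀ * H₀ + (-((X y)ᵀ * H₁ z) + -((X y)ᵀ * H₀ * X z))
          + ((-((X y)ᵀ * H₁ z) + -((X y)ᵀ * H₀ * X z)) + (H₂ y z + H₁ y * X z + (H₁ y * X z + H₀ * (X y * X z))))) := by
  rw [hX, hH₁, hH₂]
  simp only [Matrix.transpose_add, Matrix.transpose_smul, Matrix.transpose_mul, Matrix.add_mul, Matrix.smul_mul, Matrix.mul_add, Matrix.mul_smul,
    smul_add, smul_neg, neg_add]
  abel

/-- [folklore] … and **IN THE RIGHT DIRECTION** (`H₂` linear in its right slot). -/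
theorem k2_word_lin_right (H₀ : Matrix ν ν ℝ) (X H₁ : V → Matrix ν ν ℝ) (H₂ : V → V → Matrix ν ν ℝ)
    (hX : ∀ (c : ℝ) (x y : V), X (c • x + y) = c • X x + X y) (hH₁ : ∀ (c : ℝ) (x y : V), H₁ (c • x + y) = c • H₁ x + H₁ y)
    (hH₂ : ∀ (c : ℝ) (x y z : V), H₂ z (c • x + y) = c • H₂ z x + H₂ z y) (c : ℝ) (x y z : V) :
    (X z * X (c • x + y))ᵀ * H₀ + (-((X z)ᵀ * H₁ (c • x + y)) + -((X z)ᵀ * H₀ * X (c • x + y)))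
        + ((-((X z)ᵀ * H₁ (c • x + y)) + -((X z)ᵀ * H₀ * X (c • x + y)))
          + (H₂ z (c • x + y) + H₁ z * X (c • x + y) + (H₁ z * X (c • x + y) + H₀ * (X z * X (c • x + y)))))
      = c • ((X z * X x)ᵀ * H₀ + (-((X z)ᵀ * H₁ x) + -((X z)ᵀ * H₀ * X x))
          + ((-((X z)ᵀ * H₁ x) + -((X z)ᵀ * H₀ * X x)) + (H₂ z x + H₁ z * X x + (H₁ z * X x + H₀ * (X z * X x)))))
        + ((X z * X y)ᵀ * H₀ + (-((X z)ᵀ * H₁ y) + -((X z)ᵀ * H₀ * X y))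
          + ((-((X z)ᵀ * H₁ y) + -((X z)ᵀ * H₀ * X y)) + (H₂ z y + H₁ z * X y + (H₁ z * X y + H₀ * (X z * X y))))) := by
  rw [hX, hH₁, hH₂]
  simp only [Matrix.transpose_add, Matrix.transpose_smul, Matrix.transpose_mul, Matrix.add_mul, Matrix.smul_mul, Matrix.mul_add, Matrix.mul_smul,
    smul_add, smul_neg, neg_add]
  abel

omit [Fintype ν] [Fintype κ] in
/-- [folklore] **THE FIRST COMPOSITE AVERAGING JET IS LINEAR**: `𝔔₁(v) = Q₂₁(v)·Q₁₀ + Q₂₀·Q₁₁(v)` (#21's `h𝔔₁` as a function of the direction). -/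
theorem comp₁_lin (Q₁₀ : Matrix π ν ℝ) (Q₂₀ : Matrix κ π ℝ) (Q₁₁ : V → Matrix π ν ℝ) (Q₂₁ : V → Matrix κ π ℝ) (𝔔₁ : V → Matrix κ ν ℝ)
    (hQ₁₁ : ∀ (c : ℝ) (x y : V), Q₁₁ (c • x + y) = c • Q₁₁ x + Q₁₁ y) (hQ₂₁ : ∀ (c : ℝ) (x y : V), Q₂₁ (c • x + y) = c • Q₂₁ x + Q₂₁ y)
    (h𝔔₁ : ∀ v, Q₂₁ v * Q₁₀ + Q₂₀ * Q₁₁ v = 𝔔₁ v) (c : ℝ) (x y : V) :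
    𝔔₁ (c • x + y) = c • 𝔔₁ x + 𝔔₁ y := by
  rw [← h𝔔₁, ← h𝔔₁, ← h𝔔₁, hQ₁₁, hQ₂₁, Matrix.add_mul, Matrix.smul_mul, Matrix.mul_add, Matrix.mul_smul, smul_add]
  abel

omit [Fintype ν] [Fintype κ] in
/-- [folklore] **THE SECOND COMPOSITE AVERAGING JET, READ IN TWO SLOTS, IS LINEAR ON THE LEFT**:
`𝔔₂(v,v′) = Q₂₂(v,v′)·Q₁₀ + Q₂₁(v)·Q₁₁(v′) + (Q₂₁(v)·Q₁₁(v′) + Q₂₀·Q₁₂(v,v′))` (#21's `h𝔔₂` as a function of two directions). -/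
theorem comp₂_lin_left (Q₁₀ : Matrix π ν ℝ) (Q₂₀ : Matrix κ π ℝ) (Q₁₁ : V → Matrix π ν ℝ) (Q₂₁ : V → Matrix κ π ℝ)
    (Q₁₂ : V → V → Matrix π ν ℝ) (Q₂₂ : V → V → Matrix κ π ℝ) (𝔔₂ : V → V → Matrix κ ν ℝ)
    (hQ₂₁ : ∀ (c : ℝ) (x y : V), Q₂₁ (c • x + y) = c • Q₂₁ x + Q₂₁ y)
    (hQ₁₂ : ∀ (c : ℝ) (x y z : V), Q₁₂ (c • x + y) z = c • Q₁₂ x z + Q₁₂ y z)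
    (hQ₂₂ : ∀ (c : ℝ) (x y z : V), Q₂₂ (c • x + y) z = c • Q₂₂ x z + Q₂₂ y z)
    (h𝔔₂ : ∀ v v', Q₂₂ v v' * Q₁₀ + Q₂₁ v * Q₁₁ v' + (Q₂₁ v * Q₁₁ v' + Q₂₀ * Q₁₂ v v') = 𝔔₂ v v') (c : ℝ) (x y z : V) :
    𝔔₂ (c • x + y) z = c • 𝔔₂ x z + 𝔔₂ y z := by
  rw [← h𝔔₂, ← h𝔔₂, ← h𝔔₂, hQ₂₁, hQ₁₂, hQ₂₂]
  simp only [Matrix.add_mul, Matrix.smul_mul, Matrix.mul_add, Matrix.mul_smul, smul_add]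
  abel

omit [Fintype ν] [Fintype κ] in
/-- [folklore] … and **ON THE RIGHT**. -/
theorem comp₂_lin_right (Q₁₀ : Matrix π ν ℝ) (Q₂₀ : Matrix κ π ℝ) (Q₁₁ : V → Matrix π ν ℝ) (Q₂₁ : V → Matrix κ π ℝ)
    (Q₁₂ : V → V → Matrix π ν ℝ) (Q₂₂ : V → V → Matrix κ π ℝ) (𝔔₂ : V → V → Matrix κ ν ℝ)
    (hQ₁₁ : ∀ (c : ℝ) (x y : V), Q₁₁ (c • x + y) = c • Q₁₁ x + Q₁₁ y)
    (hQ₁₂ : ∀ (c : ℝ) (x y z : V), Q₁₂ z (c • x + y) = c • Q₁₂ z x + Q₁₂ z y)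
    (hQ₂₂ : ∀ (c : ℝ) (x y z : V), Q₂₂ z (c • x + y) = c • Q₂₂ z x + Q₂₂ z y)
    (h𝔔₂ : ∀ v v', Q₂₂ v v' * Q₁₀ + Q₂₁ v * Q₁₁ v' + (Q₂₁ v * Q₁₁ v' + Q₂₀ * Q₁₂ v v') = 𝔔₂ v v') (c : ℝ) (x y z : V) :
    𝔔₂ z (c • x + y) = c • 𝔔₂ z x + 𝔔₂ z y := by
  rw [← h𝔔₂, ← h𝔔₂, ← h𝔔₂, hQ₁₁, hQ₁₂, hQ₂₂]
  simp only [Matrix.add_mul, Matrix.smul_mul, Matrix.mul_add, Matrix.mul_smul, smul_add]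
  abel

/-- [folklore] **`q1`'s WORD IS LINEAR**: `v ↦ X̄(v)·𝔔₀ + 𝔔₁(v) + 𝔔₀·X(v)`. -/
theorem q1_word_lin (𝔔₀ : Matrix κ ν ℝ) (X : V → Matrix ν ν ℝ) (Xbar : V → Matrix κ κ ℝ) (𝔔₁ : V → Matrix κ ν ℝ)
    (hX : ∀ (c : ℝ) (x y : V), X (c • x + y) = c • X x + X y) (hXbar : ∀ (c : ℝ) (x y : V), Xbar (c • x + y) = c • Xbar x + Xbar y)
    (h𝔔₁ : ∀ (c : ℝ) (x y : V), 𝔔₁ (c • x + y) = c • 𝔔₁ x + 𝔔₁ y) (c : ℝ) (x y : V) :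
    Xbar (c • x + y) * 𝔔₀ + 𝔔₁ (c • x + y) + 𝔔₀ * X (c • x + y) = c • (Xbar x * 𝔔₀ + 𝔔₁ x + 𝔔₀ * X x) + (Xbar y * 𝔔₀ + 𝔔₁ y + 𝔔₀ * X y) := by
  rw [hX, hXbar, h𝔔₁, Matrix.add_mul, Matrix.smul_mul, Matrix.mul_add, Matrix.mul_smul, smul_add, smul_add]
  abel

/-- [folklore] **`q2`'s WORD, READ IN TWO SLOTS, IS LINEAR IN THE LEFT DIRECTION**. -/
theorem q2_word_lin_left (𝔔₀ : Matrix κ ν ℝ) (X : V → Matrix ν ν ℝ) (Xbar : V → Matrix κ κ ℝ) (𝔔₁ : V → Matrix κ ν ℝ)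
    (𝔔₂ : V → V → Matrix κ ν ℝ)
    (hX : ∀ (c : ℝ) (x y : V), X (c • x + y) = c • X x + X y) (hXbar : ∀ (c : ℝ) (x y : V), Xbar (c • x + y) = c • Xbar x + Xbar y)
    (h𝔔₁ : ∀ (c : ℝ) (x y : V), 𝔔₁ (c • x + y) = c • 𝔔₁ x + 𝔔₁ y) (h𝔔₂ : ∀ (c : ℝ) (x y z : V), 𝔔₂ (c • x + y) z = c • 𝔔₂ x z + 𝔔₂ y z)
    (c : ℝ) (x y z : V) :
    Xbar (c • x + y) * Xbar z * 𝔔₀ + (Xbar (c • x + y) * 𝔔₁ z + Xbar (c • x + y) * 𝔔₀ * X z)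
        + ((Xbar (c • x + y) * 𝔔₁ z + Xbar (c • x + y) * 𝔔₀ * X z)
          + (𝔔₂ (c • x + y) z + 𝔔₁ (c • x + y) * X z + (𝔔₁ (c • x + y) * X z + 𝔔₀ * (X (c • x + y) * X z))))
      = c • (Xbar x * Xbar z * 𝔔₀ + (Xbar x * 𝔔₁ z + Xbar x * 𝔔₀ * X z)
          + ((Xbar x * 𝔔₁ z + Xbar x * 𝔔₀ * X z) + (𝔔₂ x z + 𝔔₁ x * X z + (𝔔₁ x * X z + 𝔔₀ * (X x * X z)))))
        + (Xbar y * Xbar z * 𝔔₀ + (Xbar y * 𝔔₁ z + Xbar y * 𝔔₀ * X z)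
          + ((Xbar y * 𝔔₁ z + Xbar y * 𝔔₀ * X z) + (𝔔₂ y z + 𝔔₁ y * X z + (𝔔₁ y * X z + 𝔔₀ * (X y * X z))))) := by
  rw [hX, hXbar, h𝔔₁, h𝔔₂]
  simp only [Matrix.add_mul, Matrix.smul_mul, Matrix.mul_add, Matrix.mul_smul, smul_add]
  abel

/-- [folklore] … and **IN THE RIGHT DIRECTION**. -/
theorem q2_word_lin_right (𝔔₀ : Matrix κ ν ℝ) (X : V → Matrix ν ν ℝ) (Xbar : V → Matrix κ κ ℝ) (𝔔₁ : V → Matrix κ ν ℝ)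
    (𝔔₂ : V → V → Matrix κ ν ℝ)
    (hX : ∀ (c : ℝ) (x y : V), X (c • x + y) = c • X x + X y) (hXbar : ∀ (c : ℝ) (x y : V), Xbar (c • x + y) = c • Xbar x + Xbar y)
    (h𝔔₁ : ∀ (c : ℝ) (x y : V), 𝔔₁ (c • x + y) = c • 𝔔₁ x + 𝔔₁ y) (h𝔔₂ : ∀ (c : ℝ) (x y z : V), 𝔔₂ z (c • x + y) = c • 𝔔₂ z x + 𝔔₂ z y)
    (c : ℝ) (x y z : V) :
    Xbar z * Xbar (c • x + y) * 𝔔₀ + (Xbar z * 𝔔₁ (c • x + y) + Xbar z * 𝔔₀ * X (c • x + y))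
        + ((Xbar z * 𝔔₁ (c • x + y) + Xbar z * 𝔔₀ * X (c • x + y))
          + (𝔔₂ z (c • x + y) + 𝔔₁ z * X (c • x + y) + (𝔔₁ z * X (c • x + y) + 𝔔₀ * (X z * X (c • x + y)))))
      = c • (Xbar z * Xbar x * 𝔔₀ + (Xbar z * 𝔔₁ x + Xbar z * 𝔔₀ * X x)
          + ((Xbar z * 𝔔₁ x + Xbar z * 𝔔₀ * X x) + (𝔔₂ z x + 𝔔₁ z * X x + (𝔔₁ z * X x + 𝔔₀ * (X z * X x)))))
        + (Xbar z * Xbar y * 𝔔₀ + (Xbar z * 𝔔₁ y + Xbar z * 𝔔₀ * X y)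
          + ((Xbar z * 𝔔₁ y + Xbar z * 𝔔₀ * X y) + (𝔔₂ z y + 𝔔₁ z * X y + (𝔔₁ z * X y + 𝔔₀ * (X z * X y))))) := by
  rw [hX, hXbar, h𝔔₁, h𝔔₂]
  simp only [Matrix.add_mul, Matrix.smul_mul, Matrix.mul_add, Matrix.mul_smul, smul_add]
  abel

end Words

/-! ## §2 THE SOCKET: #21's conclusion shape, as ONE hypothesis for every direction, gives the three torus kernels -/

section Socket

variable {V : Type*} [AddCommGroup V] [Module ℝ V]
variable {ν κ π ρ₁ ρ₂ ρ₃ σ : Type*} [Fintype ν] [DecidableEq ν] [Fintype κ] [DecidableEq κ] [Fintype π] [DecidableEq π]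
  [Fintype ρ₁] [DecidableEq ρ₁] [Fintype ρ₂] [DecidableEq ρ₂] [Fintype ρ₃] [DecidableEq ρ₃] [Fintype σ] [DecidableEq σ]

/-- [folklore] **THE TOWER DOOR SOCKET** (SPEC #41 STEP 1, CONCRETE FOR #21's SHAPE).  Directions `v ∈ V` (abstract real module); the direction-free
structure of #21 (`N₀ F₀ G₀` the three base systems, `H₀ Q₁₀ Q₂₀ 𝔔₀`, the one-shot resolvent words `Γ I L S` of the `F` system) FREE; the `F`-side jets
`H₁ Q₁₁` and the top averaging jet `Q₂₁` LINEAR functions of `v`, the second jets `H₂ Q₁₂ Q₂₂` functions of TWO directions linear in each slot (read on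
the diagonal by the door), the chart generators `X` (finest fields) and `X̄` (top multipliers) LINEAR; the composite averaging jets `𝔔₁ 𝔔₂` and the one-shot
jets `H′₁ H′₂ 𝔔′₁ 𝔔′₂` BY THEIR DEFINING EQUATIONS — #21's namings `h𝔔₁ h𝔔₂ k1 k2 q1 q2` as functions of the direction(s), the order-2 words in the
two-slot reading (first factors along `v`, second along `v′`); the `G`-side dressed words `Gw₁ Gw₂` NAMED (#36b's `hGw₁ hGw₂` VERBATIM).  **`hdoor`** =
#21 `secondVar_oneShot_nestedStepLaw_torus_composite_graded_oneShot_of_uTop`'s conclusion at `(H₁ v, [Q₁₁ v; 0], H₂ v v, …)` for EVERY `v`.  THEN for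
every finite family `d : σ → V` and every pair `(k, l)`: #33's identity of the three torus kernels `mixedVar N₀ … = mixedVar F₀ … + mixedVar G₀ …` at the
first jets along `d k`, `d l` and the SYMMETRISED second jets `½•(J₂ (d k) (d l) + J₂ (d l) (d k))`.  Proof: §1 + #36a's word linearity + ONE call of #33
`mixedVar_kernel_law_of_directional_door` at the zero free slot. -/
theorem mixedVar_kernel_law_of_nested_door
    -- the direction-free structure
    (N₀ : Matrix (ν ⊕ (κ ⊕ ρ₁)) (ν ⊕ (κ ⊕ ρ₁)) ℝ) (F₀ : Matrix (ν ⊕ (π ⊕ ρ₂)) (ν ⊕ (π ⊕ ρ₂)) ℝ) (G₀ : Matrix (π ⊕ (κ ⊕ ρ₃)) (π ⊕ (κ ⊕ ρ₃)) ℝ)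
    (H₀ : Matrix ν ν ℝ) (Q₁₀ : Matrix π ν ℝ) (Q₂₀ : Matrix κ π ℝ) (𝔔₀ : Matrix κ ν ℝ)
    (Γ : Matrix ν ν ℝ) (I : Matrix ν (π ⊕ ρ₂) ℝ) (L : Matrix (π ⊕ ρ₂) ν ℝ) (S : Matrix (π ⊕ ρ₂) (π ⊕ ρ₂) ℝ)
    -- the chart generators, linear in the direction
    (X : V → Matrix ν ν ℝ) (hX : ∀ (c : ℝ) (x y : V), X (c • x + y) = c • X x + X y)
    (Xbar : V → Matrix κ κ ℝ) (hXbar : ∀ (c : ℝ) (x y : V), Xbar (c • x + y) = c • Xbar x + Xbar y)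
    -- the `F`-side jets and the top averaging jets: first order linear, second order bilinear (two slots)
    (H₁ : V → Matrix ν ν ℝ) (hH₁ : ∀ (c : ℝ) (x y : V), H₁ (c • x + y) = c • H₁ x + H₁ y)
    (Q₁₁ : V → Matrix π ν ℝ) (hQ₁₁ : ∀ (c : ℝ) (x y : V), Q₁₁ (c • x + y) = c • Q₁₁ x + Q₁₁ y)
    (Q₂₁ : V → Matrix κ π ℝ) (hQ₂₁ : ∀ (c : ℝ) (x y : V), Q₂₁ (c • x + y) = c • Q₂₁ x + Q₂₁ y)
    (H₂ : V → V → Matrix ν ν ℝ)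
    (hH₂l : ∀ (c : ℝ) (x y z : V), H₂ (c • x + y) z = c • H₂ x z + H₂ y z) (hH₂r : ∀ (c : ℝ) (x y z : V), H₂ z (c • x + y) = c • H₂ z x + H₂ z y)
    (Q₁₂ : V → V → Matrix π ν ℝ)
    (hQ₁₂l : ∀ (c : ℝ) (x y z : V), Q₁₂ (c • x + y) z = c • Q₁₂ x z + Q₁₂ y z) (hQ₁₂r : ∀ (c : ℝ) (x y z : V), Q₁₂ z (c • x + y) = c • Q₁₂ z x + Q₁₂ z y)
    (Q₂₂ : V → V → Matrix κ π ℝ)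
    (hQ₂₂l : ∀ (c : ℝ) (x y z : V), Q₂₂ (c • x + y) z = c • Q₂₂ x z + Q₂₂ y z) (hQ₂₂r : ∀ (c : ℝ) (x y z : V), Q₂₂ z (c • x + y) = c • Q₂₂ z x + Q₂₂ z y)
    -- the composite averaging jets, NAMED (#21's `h𝔔₁ h𝔔₂` as functions)
    (𝔔₁ : V → Matrix κ ν ℝ) (h𝔔₁ : ∀ v, Q₂₁ v * Q₁₀ + Q₂₀ * Q₁₁ v = 𝔔₁ v)
    (𝔔₂ : V → V → Matrix κ ν ℝ) (h𝔔₂ : ∀ v v', Q₂₂ v v' * Q₁₀ + Q₂₁ v * Q₁₁ v' + (Q₂₁ v * Q₁₁ v' + Q₂₀ * Q₁₂ v v') = 𝔔₂ v v')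
    -- the one-shot literal's graded jets, NAMED (#21's `k1 k2 q1 q2` as functions; order 2 in the two-slot reading)
    (H'₁ : V → Matrix ν ν ℝ) (hH'₁ : ∀ v, H'₁ v = -((X v)ᵀ * H₀) + H₁ v + H₀ * X v)
    (H'₂ : V → V → Matrix ν ν ℝ)
    (hH'₂ : ∀ v v', H'₂ v v' = (X v * X v')ᵀ * H₀ + (-((X v)ᵀ * H₁ v') + -((X v)ᵀ * H₀ * X v'))
      + ((-((X v)ᵀ * H₁ v') + -((X v)ᵀ * H₀ * X v')) + (H₂ v v' + H₁ v * X v' + (H₁ v * X v' + H₀ * (X v * X v')))))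
    (𝔔'₁ : V → Matrix κ ν ℝ) (h𝔔'₁ : ∀ v, 𝔔'₁ v = Xbar v * 𝔔₀ + 𝔔₁ v + 𝔔₀ * X v)
    (𝔔'₂ : V → V → Matrix κ ν ℝ)
    (h𝔔'₂ : ∀ v v', 𝔔'₂ v v' = Xbar v * Xbar v' * 𝔔₀ + (Xbar v * 𝔔₁ v' + Xbar v * 𝔔₀ * X v')
      + ((Xbar v * 𝔔₁ v' + Xbar v * 𝔔₀ * X v') + (𝔔₂ v v' + 𝔔₁ v * X v' + (𝔔₁ v * X v' + 𝔔₀ * (X v * X v')))))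
    -- the `G`-side DRESSED WORDS, NAMED: order 1, and the two-slot order-2 word (#36b's `hGw₁ hGw₂` shapes)
    (Gw₁ : V → Matrix π π ℝ)
    (hGw₁ : ∀ v, Gw₁ v = ((L * (H₁ v) - S * (fromRows (Q₁₁ v) (0 : Matrix ρ₂ ν ℝ))) * I + L * (fromRows (Q₁₁ v) (0 : Matrix ρ₂ ν ℝ))ᵀ * S).toBlocks₁₁)
    (Gw₂ : V → V → Matrix π π ℝ)
    (hGw₂ : ∀ v v', Gw₂ v v' =
      ((((-((L * (H₁ v) - S * (fromRows (Q₁₁ v) (0 : Matrix ρ₂ ν ℝ))) * Γ - L * (fromRows (Q₁₁ v) (0 : Matrix ρ₂ ν ℝ))ᵀ * L) * (H₁ v') + L * (H₂ v v')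
          - (((L * (H₁ v) - S * (fromRows (Q₁₁ v) (0 : Matrix ρ₂ ν ℝ))) * I + L * (fromRows (Q₁₁ v) (0 : Matrix ρ₂ ν ℝ))ᵀ * S) * (fromRows (Q₁₁ v') (0 : Matrix ρ₂ ν ℝ)) + S * (fromRows (Q₁₂ v v') (0 : Matrix ρ₂ ν ℝ)))) * I
        + (L * (H₁ v) - S * (fromRows (Q₁₁ v) (0 : Matrix ρ₂ ν ℝ))) * (-((Γ * (H₁ v') + I * (fromRows (Q₁₁ v') (0 : Matrix ρ₂ ν ℝ))) * I + Γ * (fromRows (Q₁₁ v') (0 : Matrix ρ₂ ν ℝ))ᵀ * S)))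
      - ((-((L * (H₁ v) - S * (fromRows (Q₁₁ v) (0 : Matrix ρ₂ ν ℝ))) * Γ - L * (fromRows (Q₁₁ v) (0 : Matrix ρ₂ ν ℝ))ᵀ * L) * (-(fromRows (Q₁₁ v') (0 : Matrix ρ₂ ν ℝ))ᵀ) + L * (fromRows (Q₁₂ v v') (0 : Matrix ρ₂ ν ℝ))ᵀ) * S
          + L * (-(fromRows (Q₁₁ v) (0 : Matrix ρ₂ ν ℝ))ᵀ) * ((L * (H₁ v') - S * (fromRows (Q₁₁ v') (0 : Matrix ρ₂ ν ℝ))) * I + L * (fromRows (Q₁₁ v') (0 : Matrix ρ₂ ν ℝ))ᵀ * S)))).toBlocks₁₁)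
    -- THE DOOR, for every direction, EXACTLY IN #21's CONCLUSION SHAPE (`B := [Q₁₁ v; 0]`)
    (hdoor : ∀ v : V,
      secondVar N₀
          (fromBlocks (H'₁ v) (-(fromRows (𝔔'₁ v) (0 : Matrix ρ₁ ν ℝ))ᵀ) (fromRows (𝔔'₁ v) (0 : Matrix ρ₁ ν ℝ)) 0)
          (kkt (H'₂ v v) (fromRows (𝔔'₂ v v) (0 : Matrix ρ₁ ν ℝ)))
        = secondVar F₀
            (fromBlocks (H₁ v) (-(fromRows (Q₁₁ v) (0 : Matrix ρ₂ ν ℝ))ᵀ) (fromRows (Q₁₁ v) (0 : Matrix ρ₂ ν ℝ)) 0)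
            (kkt (H₂ v v) (fromRows (Q₁₂ v v) (0 : Matrix ρ₂ ν ℝ)))
          + secondVar G₀
            (fromBlocks ((L * H₁ v - S * fromRows (Q₁₁ v) (0 : Matrix ρ₂ ν ℝ)) * I + L * (fromRows (Q₁₁ v) (0 : Matrix ρ₂ ν ℝ))ᵀ * S).toBlocks₁₁
              (-(fromRows (Q₂₁ v) (0 : Matrix ρ₃ π ℝ))ᵀ) (fromRows (Q₂₁ v) (0 : Matrix ρ₃ π ℝ)) 0)
            (kkt (((-((L * H₁ v - S * fromRows (Q₁₁ v) (0 : Matrix ρ₂ ν ℝ)) * Γ - L * (fromRows (Q₁₁ v) (0 : Matrix ρ₂ ν ℝ))ᵀ * L) * H₁ v + L * H₂ v v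
                      - (((L * H₁ v - S * fromRows (Q₁₁ v) (0 : Matrix ρ₂ ν ℝ)) * I + L * (fromRows (Q₁₁ v) (0 : Matrix ρ₂ ν ℝ))ᵀ * S) * fromRows (Q₁₁ v) (0 : Matrix ρ₂ ν ℝ)
                          + S * fromRows (Q₁₂ v v) (0 : Matrix ρ₂ ν ℝ))) * I
                    + (L * H₁ v - S * fromRows (Q₁₁ v) (0 : Matrix ρ₂ ν ℝ)) * (-((Γ * H₁ v + I * fromRows (Q₁₁ v) (0 : Matrix ρ₂ ν ℝ)) * I + Γ * (fromRows (Q₁₁ v) (0 : Matrix ρ₂ ν ℝ))ᵀ * S)))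
                  - ((-((L * H₁ v - S * fromRows (Q₁₁ v) (0 : Matrix ρ₂ ν ℝ)) * Γ - L * (fromRows (Q₁₁ v) (0 : Matrix ρ₂ ν ℝ))ᵀ * L) * (-(fromRows (Q₁₁ v) (0 : Matrix ρ₂ ν ℝ))ᵀ)
                        + L * (fromRows (Q₁₂ v v) (0 : Matrix ρ₂ ν ℝ))ᵀ) * S
                      + L * (-(fromRows (Q₁₁ v) (0 : Matrix ρ₂ ν ℝ))ᵀ) * ((L * H₁ v - S * fromRows (Q₁₁ v) (0 : Matrix ρ₂ ν ℝ)) * I + L * (fromRows (Q₁₁ v) (0 : Matrix ρ₂ ν ℝ))ᵀ * S))).toBlocks₁₁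
              (fromRows (Q₂₂ v v) (0 : Matrix ρ₃ π ℝ))))
    -- a finite family of directions, a pair
    (d : σ → V) (k l : σ) :
    mixedVar N₀
        (fromBlocks (H'₁ (d k)) (-(fromRows (𝔔'₁ (d k)) (0 : Matrix ρ₁ ν ℝ))ᵀ) (fromRows (𝔔'₁ (d k)) (0 : Matrix ρ₁ ν ℝ)) 0)
        (fromBlocks (H'₁ (d l)) (-(fromRows (𝔔'₁ (d l)) (0 : Matrix ρ₁ ν ℝ))ᵀ) (fromRows (𝔔'₁ (d l)) (0 : Matrix ρ₁ ν ℝ)) 0)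
        (kkt ((1 / 2 : ℝ) • (H'₂ (d k) (d l) + H'₂ (d l) (d k)))
          (fromRows ((1 / 2 : ℝ) • (𝔔'₂ (d k) (d l) + 𝔔'₂ (d l) (d k))) (0 : Matrix ρ₁ ν ℝ)))
      = mixedVar F₀
          (fromBlocks (H₁ (d k)) (-(fromRows (Q₁₁ (d k)) (0 : Matrix ρ₂ ν ℝ))ᵀ) (fromRows (Q₁₁ (d k)) (0 : Matrix ρ₂ ν ℝ)) 0)
          (fromBlocks (H₁ (d l)) (-(fromRows (Q₁₁ (d l)) (0 : Matrix ρ₂ ν ℝ))ᵀ) (fromRows (Q₁₁ (d l)) (0 : Matrix ρ₂ ν ℝ)) 0)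
          (kkt ((1 / 2 : ℝ) • (H₂ (d k) (d l) + H₂ (d l) (d k)))
            (fromRows ((1 / 2 : ℝ) • (Q₁₂ (d k) (d l) + Q₁₂ (d l) (d k))) (0 : Matrix ρ₂ ν ℝ)))
        + mixedVar G₀
          (fromBlocks (Gw₁ (d k)) (-(fromRows (Q₂₁ (d k)) (0 : Matrix ρ₃ π ℝ))ᵀ) (fromRows (Q₂₁ (d k)) (0 : Matrix ρ₃ π ℝ)) 0)
          (fromBlocks (Gw₁ (d l)) (-(fromRows (Q₂₁ (d l)) (0 : Matrix ρ₃ π ℝ))ᵀ) (fromRows (Q₂₁ (d l)) (0 : Matrix ρ₃ π ℝ)) 0)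
          (kkt ((1 / 2 : ℝ) • (Gw₂ (d k) (d l) + Gw₂ (d l) (d k)))
            (fromRows ((1 / 2 : ℝ) • (Q₂₂ (d k) (d l) + Q₂₂ (d l) (d k))) (0 : Matrix ρ₃ π ℝ))) := by
  -- (1) the border jets in `[·; 0]` form are linear
  have hBv : ∀ (c : ℝ) (x y : V), fromRows (Q₁₁ (c • x + y)) (0 : Matrix ρ₂ ν ℝ)
      = c • fromRows (Q₁₁ x) (0 : Matrix ρ₂ ν ℝ) + fromRows (Q₁₁ y) (0 : Matrix ρ₂ ν ℝ) := fun c x y => by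
    rw [hQ₁₁, fromRows_zero_lin]
  have hBql : ∀ (c : ℝ) (x y z : V), fromRows (Q₁₂ (c • x + y) z) (0 : Matrix ρ₂ ν ℝ)
      = c • fromRows (Q₁₂ x z) (0 : Matrix ρ₂ ν ℝ) + fromRows (Q₁₂ y z) (0 : Matrix ρ₂ ν ℝ) := fun c x y z => by
    rw [hQ₁₂l, fromRows_zero_lin]
  have hBqr : ∀ (c : ℝ) (x y z : V), fromRows (Q₁₂ z (c • x + y)) (0 : Matrix ρ₂ ν ℝ)
      = c • fromRows (Q₁₂ z x) (0 : Matrix ρ₂ ν ℝ) + fromRows (Q₁₂ z y) (0 : Matrix ρ₂ ν ℝ) := fun c x y z => by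
    rw [hQ₁₂r, fromRows_zero_lin]
  -- (2) the composite averaging jets and the one-shot jets (§1)
  have h𝔔₁l : ∀ (c : ℝ) (x y : V), 𝔔₁ (c • x + y) = c • 𝔔₁ x + 𝔔₁ y := comp₁_lin Q₁₀ Q₂₀ Q₁₁ Q₂₁ 𝔔₁ hQ₁₁ hQ₂₁ h𝔔₁
  have h𝔔₂l : ∀ (c : ℝ) (x y z : V), 𝔔₂ (c • x + y) z = c • 𝔔₂ x z + 𝔔₂ y z :=
    comp₂_lin_left Q₁₀ Q₂₀ Q₁₁ Q₂₁ Q₁₂ Q₂₂ 𝔔₂ hQ₂₁ hQ₁₂l hQ₂₂l h𝔔₂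
  have h𝔔₂r : ∀ (c : ℝ) (x y z : V), 𝔔₂ z (c • x + y) = c • 𝔔₂ z x + 𝔔₂ z y :=
    comp₂_lin_right Q₁₀ Q₂₀ Q₁₁ Q₂₁ Q₁₂ Q₂₂ 𝔔₂ hQ₁₁ hQ₁₂r hQ₂₂r h𝔔₂
  have hH'₁l : ∀ (c : ℝ) (x y : V), H'₁ (c • x + y) = c • H'₁ x + H'₁ y := fun c x y => by
    rw [hH'₁, hH'₁, hH'₁]; exact k1_word_lin H₀ X H₁ hX hH₁ c x y
  have hH'₂l : ∀ (c : ℝ) (x y z : V), H'₂ (c • x + y) z = c • H'₂ x z + H'₂ y z := fun c x y z => by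
    rw [hH'₂, hH'₂, hH'₂]; exact k2_word_lin_left H₀ X H₁ H₂ hX hH₁ hH₂l c x y z
  have hH'₂r : ∀ (c : ℝ) (x y z : V), H'₂ z (c • x + y) = c • H'₂ z x + H'₂ z y := fun c x y z => by
    rw [hH'₂, hH'₂, hH'₂]; exact k2_word_lin_right H₀ X H₁ H₂ hX hH₁ hH₂r c x y z
  have h𝔔'₁l : ∀ (c : ℝ) (x y : V), 𝔔'₁ (c • x + y) = c • 𝔔'₁ x + 𝔔'₁ y := fun c x y => by
    rw [h𝔔'₁, h𝔔'₁, h𝔔'₁]; exact q1_word_lin 𝔔₀ X Xbar 𝔔₁ hX hXbar h𝔔₁l c x y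
  have h𝔔'₂l : ∀ (c : ℝ) (x y z : V), 𝔔'₂ (c • x + y) z = c • 𝔔'₂ x z + 𝔔'₂ y z := fun c x y z => by
    rw [h𝔔'₂, h𝔔'₂, h𝔔'₂]; exact q2_word_lin_left 𝔔₀ X Xbar 𝔔₁ 𝔔₂ hX hXbar h𝔔₁l h𝔔₂l c x y z
  have h𝔔'₂r : ∀ (c : ℝ) (x y z : V), 𝔔'₂ z (c • x + y) = c • 𝔔'₂ z x + 𝔔'₂ z y := fun c x y z => by
    rw [h𝔔'₂, h𝔔'₂, h𝔔'₂]; exact q2_word_lin_right 𝔔₀ X Xbar 𝔔₁ 𝔔₂ hX hXbar h𝔔₁l h𝔔₂r c x y z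
  -- (3) the dressed words (#36a)
  have hGw₁l : ∀ (c : ℝ) (x y : V), Gw₁ (c • x + y) = c • Gw₁ x + Gw₁ y := fun c x y => by
    rw [hGw₁, hGw₁, hGw₁, ← toBlocks₁₁_lin]
    exact congrArg Matrix.toBlocks₁₁ (orderOne_word_lin I L S H₁ (fun v => fromRows (Q₁₁ v) (0 : Matrix ρ₂ ν ℝ)) hH₁ hBv c x y)
  have hGw₂l : ∀ (c : ℝ) (x y z : V), Gw₂ (c • x + y) z = c • Gw₂ x z + Gw₂ y z := fun c x y z => by
    rw [hGw₂, hGw₂, hGw₂, ← toBlocks₁₁_lin]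
    exact congrArg Matrix.toBlocks₁₁
      (orderTwo_word_lin_left Γ I L S H₁ (fun v => fromRows (Q₁₁ v) (0 : Matrix ρ₂ ν ℝ)) H₂
        (fun v v' => fromRows (Q₁₂ v v') (0 : Matrix ρ₂ ν ℝ)) hH₁ hBv hH₂l hBql c x y z)
  have hGw₂r : ∀ (c : ℝ) (x y z : V), Gw₂ z (c • x + y) = c • Gw₂ z x + Gw₂ z y := fun c x y z => by
    rw [hGw₂, hGw₂, hGw₂, ← toBlocks₁₁_lin]
    exact congrArg Matrix.toBlocks₁₁
      (orderTwo_word_lin_right Γ I L S H₁ (fun v => fromRows (Q₁₁ v) (0 : Matrix ρ₂ ν ℝ)) H₂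
        (fun v v' => fromRows (Q₁₂ v v') (0 : Matrix ρ₂ ν ℝ)) hH₁ hBv hH₂r hBqr c x y z)
  -- (4) the door with the dressed words NAMED and a ZERO free order-2 slot
  have hdoor' : ∀ (v : V) (e : ℝ), True →
      secondVar N₀
          (fromBlocks (H'₁ v) (-(fromRows (𝔔'₁ v) (0 : Matrix ρ₁ ν ℝ))ᵀ) (fromRows (𝔔'₁ v) (0 : Matrix ρ₁ ν ℝ)) 0)
          (kkt (H'₂ v v + (fun _ : ℝ => (0 : Matrix ν ν ℝ)) e) (fromRows (𝔔'₂ v v) (0 : Matrix ρ₁ ν ℝ)))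
        = secondVar F₀
            (fromBlocks (H₁ v) (-(fromRows (Q₁₁ v) (0 : Matrix ρ₂ ν ℝ))ᵀ) (fromRows (Q₁₁ v) (0 : Matrix ρ₂ ν ℝ)) 0)
            (kkt (H₂ v v + (fun _ : ℝ => (0 : Matrix ν ν ℝ)) e) (fromRows (Q₁₂ v v) (0 : Matrix ρ₂ ν ℝ)))
          + secondVar G₀
            (fromBlocks (Gw₁ v) (-(fromRows (Q₂₁ v) (0 : Matrix ρ₃ π ℝ))ᵀ) (fromRows (Q₂₁ v) (0 : Matrix ρ₃ π ℝ)) 0)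
            (kkt (Gw₂ v v + (fun _ : ℝ => (0 : Matrix π π ℝ)) e) (fromRows (Q₂₂ v v) (0 : Matrix ρ₃ π ℝ))) := by
    intro v e _
    simp only [add_zero]
    rw [hGw₁ v, hGw₂ v v]
    exact hdoor v
  -- (5) ONE call of #33
  have h := mixedVar_kernel_law_of_directional_door N₀ H'₁ 𝔔'₁ H'₂ 𝔔'₂ (fun _ : ℝ => (0 : Matrix ν ν ℝ))
    hH'₁l h𝔔'₁l hH'₂l (fun c x y z => hH'₂r c y z x) h𝔔'₂l (fun c x y z => h𝔔'₂r c y z x) (fun c x y => by rw [smul_zero, add_zero])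
    F₀ H₁ Q₁₁ H₂ Q₁₂ (fun _ : ℝ => (0 : Matrix ν ν ℝ)) hH₁ hQ₁₁ hH₂l (fun c x y z => hH₂r c y z x) hQ₁₂l (fun c x y z => hQ₁₂r c y z x)
    (fun c x y => by rw [smul_zero, add_zero])
    G₀ Gw₁ Q₂₁ Gw₂ Q₂₂ (fun _ : ℝ => (0 : Matrix π π ℝ)) hGw₁l hQ₂₁ hGw₂l (fun c x y z => hGw₂r c y z x) hQ₂₂l (fun c x y z => hQ₂₂r c y z x)
    (fun c x y => by rw [smul_zero, add_zero])
    (fun _ => True) hdoor' d (fun _ _ => (0 : ℝ)) (fun _ _ => rfl) (fun _ => trivial) k l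
  simpa only [add_zero] using h

end Socket

end Summit.QuantumFields.BalabanUV.Beta.FP.NestedDoorSocket

end
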